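import Mathlib.MeasureTheory.Integral.DivergenceTheorem
import Mathlib.Analysis.SpecialFunctions.SmoothTransition
import Mathlib.MeasureTheory.Measure.Haar.InnerProductSpace
import Literature.Analysis.Calculus.SmoothCutoff
import Literature.Analysis.FluidPDE.KatoLaiPeriodicCylinderProofs
import Literature.Analysis.FluidPDE.EnergyUniqueness
import HarnessLib

/-!
# The Gauss–Green identity on a period cell of the cylinder for tangential periodic fields

Topic `Literature/Analysis/FluidPDE`. The integration-by-parts identity behind the `L²` energy
method for the Euler equations in the periodic cylinder `{r ≤ 1} × ℝ/Lℤ` of the named facts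
`KatoLai1984_periodicCylinderUniqueness` / `…SmoothExistence` (`KatoLaiPeriodicCylinder.lean`;
T. Kato, C. Y. Lai, *Nonlinear evolution equations and the Euler flow*, J. Funct. Anal. 56
(1984), Thm I p. 17; uniqueness proof p. 23: "we have `dₜ‖u − v‖₀² = 2(u − v | dₜ(u − v))₀` for
any two solutions `u, v`", resting on §4 (iv)(c), eq. (4.10) p. 20: `(v | (u·∂)v)₀ = 0` for
solenoidal `u` tangential on `∂Ω`), stated on the **period cell of physical space**
`{r < 1} × [0, L] ⊂ ℝ³` with Lebesgue measure. (The discharge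
`KatoLai1984_periodicCylinderUniqueness_holds` in `KatoLaiPeriodicCylinderProofs.lean` runs the
energy method on the parameter box of cylindrical coordinates instead and uses the weighted
form `∫_{[0,1]×[−π,π]×[0,L]} r (div G)∘Φ = 0`, `PeriodicCylinderFlux.setIntegral_mul_divergence_cylCoord_eq_zero`;
the present Cartesian form needs no coordinates and is the one quoted in physical variables.)

The two integrations by parts of the energy argument (the transport term (4.10) and the
pressure term `(w | ∇q)₀ = 0`) are instances of one identity, proved here:

* `setIntegral_divergence_periodCell_eq_zero`: for `V : ℝ³ → ℝ³` of class `C¹` on the closed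
  cylinder `{r ≤ 1}`, tangential on the wall (`⟪V, e_r⟫ = 0` on `{r = 1}`) and `L`-periodic in
  `z` (`0 < L`), `∫_{{r<1} × [0,L]} div V = 0`.

Mathlib has the divergence theorem only for rectangular boxes
(`MeasureTheory.integral_divergence_of_hasFDerivAt_off_countable'`). The proof reduces to it:
for `0 < ε` the cut-off field `χ_ε V`, `χ_ε(y) = smoothTransition ((1 − y₀² − y₁²)/ε − 1)`
(`= 1` for `r² ≤ 1 − 2ε`, `= 0` for `r² ≥ 1 − ε`), is `C¹` on the box `[-1,1]² × [0,L]`, carries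
no flux through the lateral faces and equal fluxes through `z = 0` and `z = L` (periodicity),
so `∫_box (χ_ε div V + ⟨∇χ_ε, V⟩) = 0` (`setIntegral_box_cutoff_divergence_eq_zero`). As
`ε = 1/(n+4) → 0`, `∫ χ_ε div V → ∫_cell div V` by dominated convergence (`div V` is bounded on
the cell: continuity of the derivative within the compact convex closed cell,
`exists_bound_divergence_periodCell`), while `⟨∇χ_ε, V⟩ = smoothTransition'(·)(−2/ε)(x₀V₀ + x₁V₁)`
lives in the shell `ε ≤ 1 − r² ≤ 2ε`, where tangency and the mean value inequality give
`|x₀V₀ + x₁V₁| ≤ C_h (1 − r) ≤ C_h (1 − r²) ≤ 2 C_h ε` (`exists_bound_radialFlux`); so it is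
bounded by `4 C_ψ C_h` and tends to zero pointwise, and its integral tends to zero.

All statements are folklore calculus (Gauss–Green); no new definitions are introduced (the
period cell is written `{x | cylRadius x < 1 ∧ x 2 ∈ Icc 0 L}`).

## Mathlib / tree search

`lean search 'integral_divergence|GaussGreen|divergence_theorem'`: Mathlib
`MeasureTheory.integral_divergence_of_hasFDerivAt_off_countable'` (boxes in `Fin (n+1) → ℝ`)
and its `ℝ²`/`ℝ¹` specialisations only; tree: whole-space integration by parts under decay
(`EnergyUniqueness.integral_fderiv_apply_eq_neg_integral_mul_divergence`, `WholeSpaceIBP`), torus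
versions, and — for the cylinder — the cylindrical-coordinate (parameter box) form
`PeriodicCylinderFlux.setIntegral_mul_divergence_cylCoord_eq_zero` (landed while this file was
written); no Cartesian statement on the cell. Used from Mathlib: `Real.smoothTransition`,
`PiLp.volume_preserving_ofLp`, `MeasurePreserving.setIntegral_preimage_emb`,
`tendsto_integral_of_dominated_convergence`, `Convex.norm_image_sub_le_of_norm_fderivWithin_le`,
`ContDiffOn.continuousOn_fderivWithin`, `uniqueDiffOn_convex`, `hasFDerivAt_apply`.

## References

* T. Kato, C. Y. Lai, *Nonlinear evolution equations and the Euler flow*, J. Funct. Anal. 56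
  (1984) 15–28, §4 (iv)(c) eq. (4.10) p. 20; §5 p. 23. [KatoLai1984]
* A. J. Majda, A. L. Bertozzi, *Vorticity and Incompressible Flow*, CUP (2002), §3.1.1
  pp. 87–88 (footnote: `∫ div (h v) = 0` by the divergence theorem). [MajdaBertozziCUP2002]
-/

noncomputable section

open MeasureTheory Set Function Filter Topology TopologicalSpace WithLp
open scoped ContDiff NNReal ENNReal InnerProductSpace RealInnerProductSpace

namespace Literature.Analysis.FluidPDE

-- the calculus of `Real.smoothTransition` is the tree's (`Literature/Analysis/Calculus/SmoothCutoff`)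
open Literature.Analysis.Calculus (deriv_smoothTransition_of_nonpos deriv_smoothTransition_of_one_le
  exists_bound_deriv_smoothTransition)

/-! ### The cutoff profile `Real.smoothTransition` : derivative facts -/

/-- `smoothTransition` is differentiable with derivative `deriv smoothTransition`. [folklore] -/
theorem hasDerivAt_smoothTransition (s : ℝ) :
    HasDerivAt Real.smoothTransition (deriv Real.smoothTransition s) s :=
  ((Real.smoothTransition.contDiff (n := 1)).differentiable one_ne_zero s).hasDerivAt

/-- The derivative of `smoothTransition` is continuous. [folklore] -/
theorem continuous_deriv_smoothTransition : Continuous (deriv Real.smoothTransition) :=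
  (Real.smoothTransition.contDiff (n := 1)).continuous_deriv le_rfl

/-! ### The closed period cell `{r ≤ 1} ∩ {0 ≤ z ≤ L}` -/

/-- The closed period cell is compact. [folklore] -/
theorem isCompact_closedPeriodCell (L : ℝ) :
    IsCompact (closure (unitCylinder : Set (EuclideanSpace ℝ (Fin 3))) ∩ {x | x 2 ∈ Icc 0 L}) := by
  refine Metric.isCompact_of_isClosed_isBounded ?_ ?_
  · exact isClosed_closure.inter (isClosed_Icc.preimage (EuclideanSpace.proj (2 : Fin 3)).continuous)
  · rw [isBounded_iff_forall_norm_le]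
    refine ⟨Real.sqrt (1 + L ^ 2), fun x hx => ?_⟩
    rw [closure_unitCylinder] at hx
    obtain ⟨hr, hz⟩ := hx
    have hr' : x 0 ^ 2 + x 1 ^ 2 ≤ 1 := by
      have h1 : cylRadius x ^ 2 ≤ 1 := by
        have := cylRadius_nonneg x
        have hr1 : cylRadius x ≤ 1 := hr
        nlinarith
      rwa [cylRadius_sq] at h1
    have hz' : x 2 ^ 2 ≤ L ^ 2 := by
      obtain ⟨h0, hL⟩ := hz
      nlinarith
    rw [EuclideanSpace.norm_eq]
    refine Real.sqrt_le_sqrt ?_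
    simp only [Fin.sum_univ_three, Real.norm_eq_abs, sq_abs]
    linarith

/-- The closed period cell is convex. [folklore] -/
theorem convex_closedPeriodCell (L : ℝ) :
    Convex ℝ (closure (unitCylinder : Set (EuclideanSpace ℝ (Fin 3))) ∩ {x | x 2 ∈ Icc 0 L}) :=
  convex_unitCylinder.closure.inter
    ((convex_Icc 0 L).linear_preimage (EuclideanSpace.proj (2 : Fin 3)).toLinearMap)

/-- The closed period cell is a set of unique differentiability (convex with nonempty interior)
when `0 < L`. [folklore] -/
theorem uniqueDiffOn_closedPeriodCell {L : ℝ} (hL : 0 < L) :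
    UniqueDiffOn ℝ (closure (unitCylinder : Set (EuclideanSpace ℝ (Fin 3))) ∩ {x | x 2 ∈ Icc 0 L}) := by
  refine uniqueDiffOn_convex (convex_closedPeriodCell L) ?_
  set c : (EuclideanSpace ℝ (Fin 3)) := (L / 2) • EuclideanSpace.single (2 : Fin 3) (1 : ℝ) with hc
  have hU : IsOpen ((unitCylinder : Set (EuclideanSpace ℝ (Fin 3))) ∩ (fun x : (EuclideanSpace ℝ (Fin 3)) => x 2) ⁻¹' Ioo 0 L) :=
    unitCylinder.isOpen.inter (isOpen_Ioo.preimage (EuclideanSpace.proj (2 : Fin 3)).continuous)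
  have hsub : (unitCylinder : Set (EuclideanSpace ℝ (Fin 3))) ∩ (fun x : (EuclideanSpace ℝ (Fin 3)) => x 2) ⁻¹' Ioo 0 L ⊆
      closure (unitCylinder : Set (EuclideanSpace ℝ (Fin 3))) ∩ {x | x 2 ∈ Icc 0 L} :=
    fun x hx => ⟨subset_closure hx.1, Ioo_subset_Icc_self hx.2⟩
  refine ⟨c, (hU.subset_interior_iff.2 hsub) ⟨?_, ?_⟩⟩
  · show cylRadius c < 1
    simp [hc, cylRadius]
  · show c 2 ∈ Ioo 0 L
    simp only [hc, PiLp.smul_apply, PiLp.single_apply, if_true, smul_eq_mul, mul_one]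
    exact ⟨by linarith, by linarith⟩

/-- A field `C¹` on the closed cylinder is differentiable at the points of the open cylinder. [folklore] -/
theorem differentiableAt_of_contDiffOn_closure {F : Type*} [NormedAddCommGroup F] [NormedSpace ℝ F]
    {V : (EuclideanSpace ℝ (Fin 3)) → F} (hV : ContDiffOn ℝ 1 V (closure (unitCylinder : Set (EuclideanSpace ℝ (Fin 3))))) {x : (EuclideanSpace ℝ (Fin 3))}
    (hx : cylRadius x < 1) : DifferentiableAt ℝ V x :=
  (hV.differentiableOn one_ne_zero x (subset_closure hx)).differentiableAt
    (closure_unitCylinder_mem_nhds hx)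

/-- A field `C¹` on the closed cylinder is continuous at the points of the open cylinder. [folklore] -/
theorem continuousAt_of_contDiffOn_closure {F : Type*} [NormedAddCommGroup F] [NormedSpace ℝ F]
    {V : (EuclideanSpace ℝ (Fin 3)) → F} (hV : ContDiffOn ℝ 1 V (closure (unitCylinder : Set (EuclideanSpace ℝ (Fin 3))))) {x : (EuclideanSpace ℝ (Fin 3))}
    (hx : cylRadius x < 1) : ContinuousAt V x :=
  (hV.continuousOn.continuousWithinAt (subset_closure hx)).continuousAt
    (closure_unitCylinder_mem_nhds hx)

/-- The divergence in coordinates: `div V (x) = ∑ᵢ (DV(x) eᵢ)ᵢ`. [folklore] -/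
theorem divergence_eq_sum_fderiv_single (V : (EuclideanSpace ℝ (Fin 3)) → (EuclideanSpace ℝ (Fin 3))) (x : (EuclideanSpace ℝ (Fin 3))) :
    VectorCalculus.divergence V x = ∑ i : Fin 3, (fderiv ℝ V x (EuclideanSpace.single i 1)) i := by
  rw [divergence_eq_sum_inner_fderiv (EuclideanSpace.basisFun (Fin 3) ℝ)]
  refine Finset.sum_congr rfl fun i _ => ?_
  simp [EuclideanSpace.inner_single_left]

/-- `|div V (x)| ≤ 3 ‖DV(x)‖`. [folklore] -/
theorem abs_divergence_le (V : (EuclideanSpace ℝ (Fin 3)) → (EuclideanSpace ℝ (Fin 3))) (x : (EuclideanSpace ℝ (Fin 3))) :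
    |VectorCalculus.divergence V x| ≤ 3 * ‖fderiv ℝ V x‖ := by
  set b := EuclideanSpace.basisFun (Fin 3) ℝ
  rw [divergence_eq_sum_inner_fderiv b]
  calc |∑ i, ⟪b i, fderiv ℝ V x (b i)⟫| ≤ ∑ i, |⟪b i, fderiv ℝ V x (b i)⟫| :=
        Finset.abs_sum_le_sum_abs _ _
    _ ≤ ∑ _i : Fin 3, ‖fderiv ℝ V x‖ := Finset.sum_le_sum fun i _ =>
        (abs_inner_orthonormalBasis_le b i _).trans (norm_apply_orthonormalBasis_le b i _)
    _ = 3 * ‖fderiv ℝ V x‖ := by simp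

/-- The divergence of a field `C¹` on the closed cylinder is continuous on the open cylinder. [folklore] -/
theorem continuousOn_divergence_unitCylinder {V : (EuclideanSpace ℝ (Fin 3)) → (EuclideanSpace ℝ (Fin 3))}
    (hV : ContDiffOn ℝ 1 V (closure (unitCylinder : Set (EuclideanSpace ℝ (Fin 3))))) :
    ContinuousOn (VectorCalculus.divergence V) (unitCylinder : Set (EuclideanSpace ℝ (Fin 3))) := by
  have hD : ContinuousOn (fun x => fderiv ℝ V x) (unitCylinder : Set (EuclideanSpace ℝ (Fin 3))) :=
    (hV.mono subset_closure).continuousOn_fderiv_of_isOpen unitCylinder.isOpen le_rfl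
  have h : VectorCalculus.divergence V =
      fun x => ∑ i : Fin 3, (fderiv ℝ V x (EuclideanSpace.single i 1)) i :=
    funext (divergence_eq_sum_fderiv_single V)
  rw [h]
  refine continuousOn_finsetSum _ fun i _ => ?_
  exact (EuclideanSpace.proj i).continuous.comp_continuousOn (hD.clm_apply continuousOn_const)

/-- **Uniform bound on the divergence over a period cell**: for `V` of class `C¹` on the closed
cylinder there is `D ≥ 0` with `|div V (x)| ≤ D` for `r(x) < 1`, `0 ≤ x₂ ≤ L` (continuity of
the derivative within the compact closed cell). [folklore] -/
theorem exists_bound_divergence_periodCell {L : ℝ} (hL : 0 < L) {V : (EuclideanSpace ℝ (Fin 3)) → (EuclideanSpace ℝ (Fin 3))}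
    (hV : ContDiffOn ℝ 1 V (closure (unitCylinder : Set (EuclideanSpace ℝ (Fin 3))))) :
    ∃ D : ℝ, 0 ≤ D ∧ ∀ x : (EuclideanSpace ℝ (Fin 3)), cylRadius x < 1 → x 2 ∈ Icc 0 L →
      |VectorCalculus.divergence V x| ≤ D := by
  set KL : Set (EuclideanSpace ℝ (Fin 3)) := closure (unitCylinder : Set (EuclideanSpace ℝ (Fin 3))) ∩ {x | x 2 ∈ Icc 0 L} with hKL
  have hU : UniqueDiffOn ℝ KL := uniqueDiffOn_closedPeriodCell hL
  have hVK : ContDiffOn ℝ 1 V KL := hV.mono inter_subset_left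
  have hc : ContinuousOn (fderivWithin ℝ V KL) KL := hVK.continuousOn_fderivWithin hU le_rfl
  obtain ⟨C, hC⟩ := (isCompact_closedPeriodCell L).exists_bound_of_continuousOn hc
  have hC0 : 0 ≤ C := (norm_nonneg _).trans (hC 0 ⟨subset_closure zero_mem_unitCylinder, by
    simp only [mem_setOf_eq, PiLp.zero_apply, left_mem_Icc]; exact hL.le⟩)
  refine ⟨3 * C, by positivity, fun x hx hz => ?_⟩
  have hxK : x ∈ KL := ⟨subset_closure hx, hz⟩
  have he : fderiv ℝ V x = fderivWithin ℝ V KL x :=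
    ((differentiableAt_of_contDiffOn_closure hV hx).fderivWithin (hU x hxK)).symm
  calc |VectorCalculus.divergence V x| ≤ 3 * ‖fderiv ℝ V x‖ := abs_divergence_le V x
    _ ≤ 3 * C := by rw [he]; gcongr; exact hC x hxK

/-! ### The radial flux `x₀V₀ + x₁V₁` near the wall -/

/-- On the wall `{r = 1}` the radial flux `x₀V₀(x) + x₁V₁(x) = ⟪V x, e_r x⟫` of a tangential
field vanishes. [folklore] -/
theorem radialFlux_eq_zero_of_slip {V : (EuclideanSpace ℝ (Fin 3)) → (EuclideanSpace ℝ (Fin 3))}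
    (hslip : ∀ x ∈ frontier (unitCylinder : Set (EuclideanSpace ℝ (Fin 3))), ⟪V x, eR x⟫ = 0) {x : (EuclideanSpace ℝ (Fin 3))}
    (hx : cylRadius x = 1) : x 0 * V x 0 + x 1 * V x 1 = 0 := by
  have h := hslip x (by rw [frontier_unitCylinder]; exact hx)
  simp only [eR, hx, inv_one, one_smul, PiLp.inner_apply, Fin.sum_univ_three,
    RCLike.inner_apply, conj_trivial, Matrix.cons_val_zero, Matrix.cons_val_one,
    Matrix.cons_val_two, Matrix.tail_cons, Matrix.head_cons] at h
  linarith

/-- **Lipschitz bound for the radial flux near the wall.** For `V` of class `C¹` on the closed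
cylinder and tangential on the wall there is `C ≥ 0` with
`|x₀V₀(x) + x₁V₁(x)| ≤ C (1 − r(x))` for `0 < r(x) ≤ 1`, `0 ≤ x₂ ≤ L` (mean value inequality on
the compact convex closed cell along the radial segment to the wall, where the flux vanishes). [folklore] -/
theorem exists_bound_radialFlux {L : ℝ} (hL : 0 < L) {V : (EuclideanSpace ℝ (Fin 3)) → (EuclideanSpace ℝ (Fin 3))}
    (hV : ContDiffOn ℝ 1 V (closure (unitCylinder : Set (EuclideanSpace ℝ (Fin 3)))))
    (hslip : ∀ x ∈ frontier (unitCylinder : Set (EuclideanSpace ℝ (Fin 3))), ⟪V x, eR x⟫ = 0) :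
    ∃ C : ℝ, 0 ≤ C ∧ ∀ x : (EuclideanSpace ℝ (Fin 3)), 0 < cylRadius x → cylRadius x ≤ 1 → x 2 ∈ Icc 0 L →
      |x 0 * V x 0 + x 1 * V x 1| ≤ C * (1 - cylRadius x) := by
  set KL : Set (EuclideanSpace ℝ (Fin 3)) := closure (unitCylinder : Set (EuclideanSpace ℝ (Fin 3))) ∩ {x | x 2 ∈ Icc 0 L} with hKL
  set h : (EuclideanSpace ℝ (Fin 3)) → ℝ := fun x => x 0 * V x 0 + x 1 * V x 1 with hh
  have hU : UniqueDiffOn ℝ KL := uniqueDiffOn_closedPeriodCell hL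
  have hcoord : ∀ i : Fin 3, ContDiff ℝ 1 (fun x : (EuclideanSpace ℝ (Fin 3)) => x i) := fun i =>
    contDiff_piLp_apply (p := 2)
  have hcomp : ∀ i : Fin 3, ContDiffOn ℝ 1 (fun x => V x i) (closure (unitCylinder : Set (EuclideanSpace ℝ (Fin 3)))) :=
    (contDiffOn_piLp 2).1 hV
  have hhK : ContDiffOn ℝ 1 h KL :=
    (((hcoord 0).contDiffOn.mul (hcomp 0)).add ((hcoord 1).contDiffOn.mul (hcomp 1))).mono
      inter_subset_left
  have hc : ContinuousOn (fderivWithin ℝ h KL) KL := hhK.continuousOn_fderivWithin hU le_rfl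
  obtain ⟨C, hC⟩ := (isCompact_closedPeriodCell L).exists_bound_of_continuousOn hc
  have h0K : (0 : (EuclideanSpace ℝ (Fin 3))) ∈ KL := ⟨subset_closure zero_mem_unitCylinder, by
    simp only [mem_setOf_eq, PiLp.zero_apply, left_mem_Icc]; exact hL.le⟩
  have hC0 : 0 ≤ C := (norm_nonneg _).trans (hC 0 h0K)
  refine ⟨C, hC0, fun x hr0 hr1 hz => ?_⟩
  -- the radial projection `x'` of `x` to the wall
  set r : ℝ := cylRadius x with hr
  set x' : (EuclideanSpace ℝ (Fin 3)) := x + (r⁻¹ - 1) • horizontalProj x with hx'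
  have hx'0 : x' 0 = r⁻¹ * x 0 := by
    simp [hx', horizontalProj]
    ring
  have hx'1 : x' 1 = r⁻¹ * x 1 := by
    simp [hx', horizontalProj]
    ring
  have hx'2 : x' 2 = x 2 := by
    simp [hx', horizontalProj]
  have hrne : r ≠ 0 := hr0.ne'
  have hr' : cylRadius x' = 1 := by
    have h2 : x 0 ^ 2 + x 1 ^ 2 = r ^ 2 := (cylRadius_sq x).symm
    show Real.sqrt (x' 0 ^ 2 + x' 1 ^ 2) = 1
    rw [hx'0, hx'1, Real.sqrt_eq_one]
    field_simp
    linarith [h2]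
  have hx'K : x' ∈ KL :=
    ⟨by rw [closure_unitCylinder]; exact le_of_eq hr', by rw [mem_setOf_eq, hx'2]; exact hz⟩
  have hxK : x ∈ KL := ⟨by rw [closure_unitCylinder]; exact hr1, hz⟩
  have hzero : h x' = 0 := radialFlux_eq_zero_of_slip hslip hr'
  have hmvt : ‖h x - h x'‖ ≤ C * ‖x - x'‖ :=
    (convex_closedPeriodCell L).norm_image_sub_le_of_norm_fderivWithin_le
      (hhK.differentiableOn one_ne_zero) hC hx'K hxK
  have hinv : 0 ≤ r⁻¹ - 1 := sub_nonneg.2 ((one_le_inv₀ hr0).2 hr1)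
  have hdist : ‖x - x'‖ = 1 - r := by
    have e : x - x' = -((r⁻¹ - 1) • horizontalProj x) := by rw [hx']; abel
    rw [e, norm_neg, norm_smul, norm_horizontalProj, Real.norm_eq_abs, abs_of_nonneg hinv, ← hr]
    field_simp
  rw [hzero, sub_zero, Real.norm_eq_abs, hdist] at hmvt
  exact hmvt

/-! ### Coordinates `y : Fin 3 → ℝ` and the cut-off integrands -/

/-- The cylindrical radius in coordinates: `r (toLp y) = √(y₀² + y₁²)`. [folklore] -/
theorem cylRadius_toLp (y : Fin 3 → ℝ) :
    cylRadius (toLp 2 y : (EuclideanSpace ℝ (Fin 3))) = Real.sqrt (y 0 ^ 2 + y 1 ^ 2) := rfl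

/-- `r (toLp y) < 1 ↔ y₀² + y₁² < 1`. [folklore] -/
theorem cylRadius_toLp_lt_one_iff (y : Fin 3 → ℝ) :
    cylRadius (toLp 2 y : (EuclideanSpace ℝ (Fin 3))) < 1 ↔ y 0 ^ 2 + y 1 ^ 2 < 1 := by
  rw [cylRadius_toLp, Real.sqrt_lt' one_pos, one_pow]

/-- The squared radius `y₀² + y₁²` is a continuous function of the coordinates. [folklore] -/
theorem continuous_rhoSq : Continuous fun y : Fin 3 → ℝ => y 0 ^ 2 + y 1 ^ 2 := by
  fun_prop

/-- Beyond the radius `√(1 − ε)` the cut-off `smoothTransition ((1 − ρ)/ε − 1)` vanishes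
identically, and so does the derivative factor `smoothTransition' ((1 − ρ)/ε − 1)`. [folklore] -/
theorem cutoff_eq_zero_of_lt {ε ρ : ℝ} (hε : 0 < ε) (h : 1 - ε < ρ) :
    Real.smoothTransition ((1 - ρ) / ε - 1) = 0 ∧
      deriv Real.smoothTransition ((1 - ρ) / ε - 1) = 0 := by
  have h1 : (1 - ρ) / ε - 1 < 0 := by
    rw [sub_neg, div_lt_one hε]
    linarith
  exact ⟨Real.smoothTransition.zero_of_nonpos h1.le, deriv_smoothTransition_of_nonpos h1.le⟩

/-- **Continuity of the cut-off divergence** `y ↦ χ_ε(y) div V (toLp y)`,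
`χ_ε = smoothTransition ((1 − y₀² − y₁²)/ε − 1)`: continuous at points with `y₀² + y₁² < 1`
(the divergence is continuous on the open cylinder) and locally zero elsewhere. [folklore] -/
theorem continuous_cutoff_mul_divergence {ε : ℝ} (hε : 0 < ε) {V : (EuclideanSpace ℝ (Fin 3)) → (EuclideanSpace ℝ (Fin 3))}
    (hV : ContDiffOn ℝ 1 V (closure (unitCylinder : Set (EuclideanSpace ℝ (Fin 3))))) :
    Continuous fun y : Fin 3 → ℝ =>
      Real.smoothTransition ((1 - (y 0 ^ 2 + y 1 ^ 2)) / ε - 1) *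
        VectorCalculus.divergence V (toLp 2 y) := by
  have hχ : Continuous fun y : Fin 3 → ℝ =>
      Real.smoothTransition ((1 - (y 0 ^ 2 + y 1 ^ 2)) / ε - 1) :=
    Real.smoothTransition.continuous.comp (by fun_prop)
  refine continuous_iff_continuousAt.2 fun y => ?_
  by_cases hρ : y 0 ^ 2 + y 1 ^ 2 < 1
  · have hx : cylRadius (toLp 2 y : (EuclideanSpace ℝ (Fin 3))) < 1 := (cylRadius_toLp_lt_one_iff y).2 hρ
    have hd : ContinuousAt (VectorCalculus.divergence V) (toLp 2 y : (EuclideanSpace ℝ (Fin 3))) :=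
      (continuousOn_divergence_unitCylinder hV).continuousAt (unitCylinder.isOpen.mem_nhds hx)
    exact hχ.continuousAt.mul (hd.comp (PiLp.continuous_toLp 2 _).continuousAt)
  · have hW : IsOpen {y : Fin 3 → ℝ | 1 - ε < y 0 ^ 2 + y 1 ^ 2} :=
      isOpen_lt continuous_const continuous_rhoSq
    have hy : y ∈ {y : Fin 3 → ℝ | 1 - ε < y 0 ^ 2 + y 1 ^ 2} := by
      show 1 - ε < y 0 ^ 2 + y 1 ^ 2
      linarith [not_lt.1 hρ]
    refine EventuallyEq.continuousAt (y := (0 : ℝ)) ?_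
    filter_upwards [hW.mem_nhds hy] with y' hy'
    rw [(cutoff_eq_zero_of_lt hε hy').1, zero_mul]

/-- **Continuity of the cut-off flux term**
`y ↦ smoothTransition' ((1 − ρ)/ε − 1) · (−2/ε) · (y₀V₀ + y₁V₁)(toLp y)`: continuous at points
with `ρ = y₀² + y₁² < 1` and locally zero elsewhere. [folklore] -/
theorem continuous_cutoffDeriv_mul_flux {ε : ℝ} (hε : 0 < ε) {V : (EuclideanSpace ℝ (Fin 3)) → (EuclideanSpace ℝ (Fin 3))}
    (hV : ContDiffOn ℝ 1 V (closure (unitCylinder : Set (EuclideanSpace ℝ (Fin 3))))) :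
    Continuous fun y : Fin 3 → ℝ =>
      deriv Real.smoothTransition ((1 - (y 0 ^ 2 + y 1 ^ 2)) / ε - 1) * (-2 / ε) *
        (y 0 * V (toLp 2 y) 0 + y 1 * V (toLp 2 y) 1) := by
  have hχ' : Continuous fun y : Fin 3 → ℝ =>
      deriv Real.smoothTransition ((1 - (y 0 ^ 2 + y 1 ^ 2)) / ε - 1) * (-2 / ε) :=
    (continuous_deriv_smoothTransition.comp (by fun_prop)).mul continuous_const
  refine continuous_iff_continuousAt.2 fun y => ?_
  by_cases hρ : y 0 ^ 2 + y 1 ^ 2 < 1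
  · have hx : cylRadius (toLp 2 y : (EuclideanSpace ℝ (Fin 3))) < 1 := (cylRadius_toLp_lt_one_iff y).2 hρ
    have hWc : ContinuousAt (fun y : Fin 3 → ℝ => V (toLp 2 y)) y :=
      (continuousAt_of_contDiffOn_closure hV hx).comp (PiLp.continuous_toLp 2 _).continuousAt
    have hW0 : ContinuousAt (fun y : Fin 3 → ℝ => V (toLp 2 y) 0) y :=
      (EuclideanSpace.proj (0 : Fin 3)).continuous.continuousAt.comp hWc
    have hW1 : ContinuousAt (fun y : Fin 3 → ℝ => V (toLp 2 y) 1) y :=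
      (EuclideanSpace.proj (1 : Fin 3)).continuous.continuousAt.comp hWc
    exact hχ'.continuousAt.mul (((continuous_apply 0).continuousAt.mul hW0).add
      ((continuous_apply 1).continuousAt.mul hW1))
  · have hW : IsOpen {y : Fin 3 → ℝ | 1 - ε < y 0 ^ 2 + y 1 ^ 2} :=
      isOpen_lt continuous_const continuous_rhoSq
    have hy : y ∈ {y : Fin 3 → ℝ | 1 - ε < y 0 ^ 2 + y 1 ^ 2} := by
      show 1 - ε < y 0 ^ 2 + y 1 ^ 2
      linarith [not_lt.1 hρ]
    refine EventuallyEq.continuousAt (y := (0 : ℝ)) ?_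
    filter_upwards [hW.mem_nhds hy] with y' hy'
    rw [(cutoff_eq_zero_of_lt hε hy').2, zero_mul, zero_mul]

/-! ### The divergence theorem on the box `[-1,1]² × [0,L]` for the cut-off field -/

/-- Coordinates of points inserted on the faces `z = c`: `(insertNth 2 c z)₀ = z₀`. [folklore] -/
theorem insertNth_two_apply_zero (c : ℝ) (z : Fin 2 → ℝ) :
    (Fin.insertNth 2 c z : Fin 3 → ℝ) 0 = z 0 := rfl

/-- Coordinates of points inserted on the faces `z = c`: `(insertNth 2 c z)₁ = z₁`. [folklore] -/
theorem insertNth_two_apply_one (c : ℝ) (z : Fin 2 → ℝ) :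
    (Fin.insertNth 2 c z : Fin 3 → ℝ) 1 = z 1 := rfl

/-- The top face point is the bottom face point shifted by `L e_z`. [folklore] -/
theorem toLp_insertNth_two (L : ℝ) (z : Fin 2 → ℝ) :
    (toLp 2 (Fin.insertNth 2 L z) : (EuclideanSpace ℝ (Fin 3))) =
      toLp 2 (Fin.insertNth 2 0 z) + L • EuclideanSpace.single (2 : Fin 3) (1 : ℝ) := by
  ext i
  fin_cases i
  · simp; rfl
  · simp; rfl
  · simp

/-- **The box identity.** For `V` of class `C¹` on the closed cylinder and `L`-periodic in
`z`, `0 < L`, `0 < ε`, the divergence of the cut-off field `χ_ε V`,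
`χ_ε(y) = smoothTransition ((1 − y₀² − y₁²)/ε − 1)` (equal to `1` for `y₀² + y₁² ≤ 1 − 2ε`, to
`0` for `y₀² + y₁² ≥ 1 − ε`), integrates to zero over the box `[-1,1]² × [0,L]`: Mathlib's
divergence theorem on the box (`integral_divergence_of_hasFDerivAt_off_countable'`), the
lateral faces `y₀ = ±1`, `y₁ = ±1` carrying no flux (`χ_ε = 0` there) and the faces `y₂ = 0`,
`y₂ = L` cancelling by periodicity. The divergence is written out as
`χ_ε div V + ⟨∇χ_ε, V⟩ = χ_ε div V + smoothTransition'(·) (−2/ε) (y₀V₀ + y₁V₁)`. [folklore] -/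
theorem setIntegral_box_cutoff_divergence_eq_zero {L ε : ℝ} (hL : 0 < L) (hε : 0 < ε)
    {V : (EuclideanSpace ℝ (Fin 3)) → (EuclideanSpace ℝ (Fin 3))} (hV : ContDiffOn ℝ 1 V (closure (unitCylinder : Set (EuclideanSpace ℝ (Fin 3)))))
    (hper : IsAxiallyPeriodic L V) :
    ∫ y in Icc ![-1, -1, 0] ![1, 1, L],
      (Real.smoothTransition ((1 - (y 0 ^ 2 + y 1 ^ 2)) / ε - 1) *
          VectorCalculus.divergence V (toLp 2 y) +
        deriv Real.smoothTransition ((1 - (y 0 ^ 2 + y 1 ^ 2)) / ε - 1) * (-2 / ε) *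
          (y 0 * V (toLp 2 y) 0 + y 1 * V (toLp 2 y) 1)) = 0 := by
  -- notation
  set a : Fin 3 → ℝ := ![-1, -1, 0] with ha
  set b : Fin 3 → ℝ := ![1, 1, L] with hb
  set ρ : (Fin 3 → ℝ) → ℝ := fun y => y 0 ^ 2 + y 1 ^ 2 with hρ
  set g : (Fin 3 → ℝ) → ℝ := fun y => (1 - ρ y) / ε - 1 with hg
  set χ : (Fin 3 → ℝ) → ℝ := fun y => Real.smoothTransition (g y) with hχ
  set T := (EuclideanSpace.equiv (Fin 3) ℝ).symm with hT
  have hTy : ∀ y, T y = toLp 2 y := fun _ => rfl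
  set W : (Fin 3 → ℝ) → (EuclideanSpace ℝ (Fin 3)) := fun y => V (toLp 2 y) with hW
  set f : Fin 3 → (Fin 3 → ℝ) → ℝ := fun i y => χ y * W y i with hf
  set g' : (Fin 3 → ℝ) → (Fin 3 → ℝ) →L[ℝ] ℝ := fun y =>
    (-(2 / ε) * y 0) • ContinuousLinearMap.proj 0 + (-(2 / ε) * y 1) • ContinuousLinearMap.proj 1
    with hg'
  set χ' : (Fin 3 → ℝ) → (Fin 3 → ℝ) →L[ℝ] ℝ := fun y =>
    deriv Real.smoothTransition (g y) • g' y with hχ'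
  set D : (Fin 3 → ℝ) → (Fin 3 → ℝ) →L[ℝ] (EuclideanSpace ℝ (Fin 3)) := fun y =>
    (fderiv ℝ V (toLp 2 y)).comp T.toContinuousLinearMap with hD
  set f' : Fin 3 → (Fin 3 → ℝ) → (Fin 3 → ℝ) →L[ℝ] ℝ := fun i y =>
    if ρ y < 1 then χ y • ((EuclideanSpace.proj (𝕜 := ℝ) i).comp (D y)) + (W y i) • χ' y else 0
    with hf'
  set F : (Fin 3 → ℝ) → ℝ := fun y =>
    Real.smoothTransition ((1 - (y 0 ^ 2 + y 1 ^ 2)) / ε - 1) *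
        VectorCalculus.divergence V (toLp 2 y) +
      deriv Real.smoothTransition ((1 - (y 0 ^ 2 + y 1 ^ 2)) / ε - 1) * (-2 / ε) *
        (y 0 * V (toLp 2 y) 0 + y 1 * V (toLp 2 y) 1) with hF
  -- (S1) derivative of the argument `g` of the cut-off
  have hgd : ∀ y, HasFDerivAt g (g' y) y := by
    intro y
    have h0 : HasFDerivAt (fun y : Fin 3 → ℝ => y 0) (ContinuousLinearMap.proj (R := ℝ) 0) y :=
      hasFDerivAt_apply 0 y
    have h1 : HasFDerivAt (fun y : Fin 3 → ℝ => y 1) (ContinuousLinearMap.proj (R := ℝ) 1) y :=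
      hasFDerivAt_apply 1 y
    have h := ((((h0.mul h0).add (h1.mul h1)).const_sub 1).mul_const ε⁻¹).sub_const 1
    have he : g = fun y : Fin 3 → ℝ => (1 - (y 0 * y 0 + y 1 * y 1)) * ε⁻¹ - 1 := by
      funext y
      simp only [hg, hρ, div_eq_mul_inv, sq]
    rw [he]
    refine h.congr_fderiv ?_
    ext v
    simp [hg']
    ring
  -- (S2) derivative of the cut-off
  have hχd : ∀ y, HasFDerivAt χ (χ' y) y := fun y =>
    (hasDerivAt_smoothTransition (g y)).comp_hasFDerivAt y (hgd y)
  -- (S3) derivative of `W = V ∘ toLp` inside the cylinder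
  have hWd : ∀ y, ρ y < 1 → HasFDerivAt W (D y) y := by
    intro y hy
    have hx : cylRadius (toLp 2 y : (EuclideanSpace ℝ (Fin 3))) < 1 := (cylRadius_toLp_lt_one_iff y).2 hy
    exact (differentiableAt_of_contDiffOn_closure hV hx).hasFDerivAt.comp y T.hasFDerivAt
  -- (S4) the cut-off and its derivative factor vanish near and beyond the wall
  have hWopen : IsOpen {y : Fin 3 → ℝ | 1 - ε < ρ y} := isOpen_lt continuous_const continuous_rhoSq
  have hvan : ∀ y, 1 - ε < ρ y → χ y = 0 ∧ deriv Real.smoothTransition (g y) = 0 :=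
    fun y hy => cutoff_eq_zero_of_lt hε hy
  have hmemW : ∀ y, ¬ ρ y < 1 → y ∈ {y : Fin 3 → ℝ | 1 - ε < ρ y} := fun y hy => by
    show 1 - ε < ρ y
    linarith [not_lt.1 hy]
  -- (S5) the derivative of the components `f i`
  have hfd : ∀ y i, HasFDerivAt (f i) (f' i y) y := by
    intro y i
    by_cases hy : ρ y < 1
    · have e : f' i y = χ y • ((EuclideanSpace.proj (𝕜 := ℝ) i).comp (D y)) + (W y i) • χ' y :=
        if_pos hy
      rw [e]
      have hWi : HasFDerivAt (fun y => W y i) ((EuclideanSpace.proj (𝕜 := ℝ) i).comp (D y)) y :=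
        (EuclideanSpace.proj (𝕜 := ℝ) i).hasFDerivAt.comp y (hWd y hy)
      exact (hχd y).mul hWi
    · have e : f' i y = 0 := if_neg hy
      rw [e]
      refine (hasFDerivAt_const (0 : ℝ) y).congr_of_eventuallyEq ?_
      filter_upwards [hWopen.mem_nhds (hmemW y hy)] with y' hy'
      show χ y' * W y' i = 0
      rw [(hvan y' hy').1, zero_mul]
  -- (S6) continuity of the components
  have hfc : ∀ i, Continuous (f i) := fun i =>
    continuous_iff_continuousAt.2 fun y => (hfd y i).continuousAt
  -- (S7) the divergence of the cut-off field
  have hsum : ∀ y, ∑ i, f' i y (Pi.single i 1) = F y := by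
    intro y
    by_cases hy : ρ y < 1
    · have e : ∀ i, f' i y = χ y • ((EuclideanSpace.proj (𝕜 := ℝ) i).comp (D y)) + (W y i) • χ' y :=
        fun i => if_pos hy
      simp only [e, hF, hD, hχ', hg', hW, hχ, hg, hρ, add_apply,
        FunLike.coe_smul, Pi.smul_apply, ContinuousLinearMap.comp_apply,
        ContinuousLinearEquiv.coe_coe, hTy, smul_eq_mul,
        ContinuousLinearMap.proj_apply, Fin.sum_univ_three, PiLp.toLp_single, Pi.single_apply]
      rw [divergence_eq_sum_fderiv_single V (toLp 2 y), Fin.sum_univ_three]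
      simp
      ring
    · have e : ∀ i, f' i y = 0 := fun i => if_neg hy
      simp only [e, zero_apply, Finset.sum_const_zero, hF]
      have h := hvan y (hmemW y hy)
      simp only [hχ, hg, hρ] at h
      rw [h.1, h.2]
      ring
  -- (S8) integrability of the divergence on the box
  have hFc : Continuous F :=
    (continuous_cutoff_mul_divergence hε hV).add (continuous_cutoffDeriv_mul_flux hε hV)
  have hFi : IntegrableOn (fun y => ∑ i, f' i y (Pi.single i 1)) (Icc a b) := by
    have e : (fun y => ∑ i, f' i y (Pi.single i 1)) = F := funext hsum
    rw [e]
    exact hFc.continuousOn.integrableOn_compact isCompact_Icc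
  -- (S9) the divergence theorem on the box
  have hle : a ≤ b := fun i => by fin_cases i <;> simp [ha, hb, hL.le]
  have hDT := integral_divergence_of_hasFDerivAt_off_countable' a b hle f f' ∅ countable_empty
    (fun i => (hfc i).continuousOn) (fun y _ i => hfd y i) hFi
  -- (S10) the face integrals vanish or cancel
  have hface0 : ∀ (c : ℝ) (z : Fin 2 → ℝ), c ^ 2 = 1 → f 0 (Fin.insertNth 0 c z) = 0 := by
    intro c z hc
    have hy : ¬ ρ (Fin.insertNth 0 c z) < 1 := by
      simp only [hρ, Fin.insertNth_apply_same, hc, not_lt]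
      nlinarith [sq_nonneg ((Fin.insertNth 0 c z : Fin 3 → ℝ) 1)]
    show χ _ * W _ 0 = 0
    rw [(hvan _ (hmemW _ hy)).1, zero_mul]
  have hface1 : ∀ (c : ℝ) (z : Fin 2 → ℝ), c ^ 2 = 1 → f 1 (Fin.insertNth 1 c z) = 0 := by
    intro c z hc
    have hy : ¬ ρ (Fin.insertNth 1 c z) < 1 := by
      simp only [hρ, Fin.insertNth_apply_same, hc, not_lt]
      nlinarith [sq_nonneg ((Fin.insertNth 1 c z : Fin 3 → ℝ) 0)]
    show χ _ * W _ 1 = 0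
    rw [(hvan _ (hmemW _ hy)).1, zero_mul]
  have hface2 : ∀ z : Fin 2 → ℝ, f 2 (Fin.insertNth 2 (b 2) z) = f 2 (Fin.insertNth 2 (a 2) z) := by
    intro z
    have hb2 : b 2 = L := by simp [hb]
    have ha2 : a 2 = 0 := by simp [ha]
    rw [hb2, ha2]
    show χ _ * W _ 2 = χ _ * W _ 2
    have hχe : χ (Fin.insertNth 2 L z) = χ (Fin.insertNth 2 0 z) := by
      simp only [hχ, hg, hρ, insertNth_two_apply_zero, insertNth_two_apply_one]
    have hWe : W (Fin.insertNth 2 L z) = W (Fin.insertNth 2 0 z) := by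
      simp only [hW, toLp_insertNth_two L z]
      exact hper _
    rw [hχe, hWe]
  have hfaces : ∑ i : Fin 3,
      ((∫ z in Icc (a ∘ i.succAbove) (b ∘ i.succAbove), f i (i.insertNth (b i) z)) -
        ∫ z in Icc (a ∘ i.succAbove) (b ∘ i.succAbove), f i (i.insertNth (a i) z)) = 0 := by
    rw [Fin.sum_univ_three]
    have hb0 : b 0 = 1 := by simp [hb]
    have ha0 : a 0 = -1 := by simp [ha]
    have hb1 : b 1 = 1 := by simp [hb]
    have ha1 : a 1 = -1 := by simp [ha]
    have e0 : (fun z => f 0 (Fin.insertNth 0 (b 0) z)) = fun _ => 0 :=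
      funext fun z => hface0 _ z (by rw [hb0]; norm_num)
    have e0' : (fun z => f 0 (Fin.insertNth 0 (a 0) z)) = fun _ => 0 :=
      funext fun z => hface0 _ z (by rw [ha0]; norm_num)
    have e1 : (fun z => f 1 (Fin.insertNth 1 (b 1) z)) = fun _ => 0 :=
      funext fun z => hface1 _ z (by rw [hb1]; norm_num)
    have e1' : (fun z => f 1 (Fin.insertNth 1 (a 1) z)) = fun _ => 0 :=
      funext fun z => hface1 _ z (by rw [ha1]; norm_num)
    have e2 : (fun z => f 2 (Fin.insertNth 2 (b 2) z)) = fun z => f 2 (Fin.insertNth 2 (a 2) z) :=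
      funext hface2
    simp only [e0, e0', e1, e1', e2, integral_zero, sub_self, add_zero]
  -- conclusion
  rw [hfaces] at hDT
  rw [← hDT]
  exact (setIntegral_congr_fun measurableSet_Icc fun y _ => (hsum y).symm)

/-! ### Gauss–Green on the period cell -/

/-- The period cell `{r < 1} × [0, L]` is the preimage under the coordinate map of the part of
the box `[-1,1]² × [0,L]` inside the cylinder. [folklore] -/
theorem preimage_ofLp_box_inter_cylinder (L : ℝ) :
    (ofLp : (EuclideanSpace ℝ (Fin 3)) → (Fin 3 → ℝ)) ⁻¹'
        ({y : Fin 3 → ℝ | y 0 ^ 2 + y 1 ^ 2 < 1} ∩ Icc ![-1, -1, 0] ![1, 1, L]) =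
      {x : (EuclideanSpace ℝ (Fin 3)) | cylRadius x < 1 ∧ x 2 ∈ Icc 0 L} := by
  ext x
  simp only [mem_preimage, mem_inter_iff, mem_setOf_eq, mem_Icc]
  constructor
  · rintro ⟨h1, h2, h3⟩
    refine ⟨(cylRadius_toLp_lt_one_iff (ofLp x)).2 h1, ?_, ?_⟩
    · have := h2 2
      simpa using this
    · have := h3 2
      simpa using this
  · rintro ⟨h1, h2, h3⟩
    have hρ : (ofLp x) 0 ^ 2 + (ofLp x) 1 ^ 2 < 1 := (cylRadius_toLp_lt_one_iff (ofLp x)).1 h1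
    refine ⟨hρ, fun i => ?_, fun i => ?_⟩
    · fin_cases i
      · show (-1 : ℝ) ≤ x 0
        nlinarith [sq_nonneg (x 1), sq_nonneg (x 0 + 1)]
      · show (-1 : ℝ) ≤ x 1
        nlinarith [sq_nonneg (x 0), sq_nonneg (x 1 + 1)]
      · show (0 : ℝ) ≤ x 2
        exact h2
    · fin_cases i
      · show x 0 ≤ 1
        nlinarith [sq_nonneg (x 1), sq_nonneg (x 0 - 1)]
      · show x 1 ≤ 1
        nlinarith [sq_nonneg (x 0), sq_nonneg (x 1 - 1)]
      · show x 2 ≤ L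
        exact h3

/-- **Gauss–Green on a period cell of the cylinder for tangential periodic fields.** Let
`V : ℝ³ → ℝ³` be of class `C¹` on the closed cylinder `{r ≤ 1}`, tangential on the wall
(`⟪V, e_r⟫ = 0` on `{r = 1}`) and `L`-periodic in `z`, `0 < L`. Then
`∫_{{r < 1} × [0, L]} div V dx = 0`:
the divergence theorem (Gauss–Green) on the period cell, whose boundary flux vanishes on the
wall by tangency and cancels on the faces `z = 0`, `z = L` by periodicity — the identity
behind Kato–Lai 1984, §4 (iv)(c) eq. (4.10) p. 20, `(v | (u·∂)v)₀ = 0` for solenoidal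
tangential `u`, and behind `(w | ∇q)₀ = 0` for solenoidal tangential `w`. Proof: the box
identity `setIntegral_box_cutoff_divergence_eq_zero` for the cut-off fields `χ_ε V`,
`ε = 1/(n+4) → 0`; `∫ χ_ε div V → ∫_cell div V` by dominated convergence (the divergence is
bounded on the cell, `exists_bound_divergence_periodCell`), and the flux term
`(2/ε) smoothTransition'(·) (x₀V₀ + x₁V₁)`, supported in the shell `ε ≤ 1 − r² ≤ 2ε`, is
bounded by `4 C_ψ C_h` (`exists_bound_radialFlux`: `|x₀V₀ + x₁V₁| ≤ C_h (1 − r)` by tangency)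
and tends to zero pointwise, so its integral tends to zero. [folklore] -/
theorem setIntegral_divergence_periodCell_eq_zero {L : ℝ} (hL : 0 < L) {V : (EuclideanSpace ℝ (Fin 3)) → (EuclideanSpace ℝ (Fin 3))}
    (hV : ContDiffOn ℝ 1 V (closure (unitCylinder : Set (EuclideanSpace ℝ (Fin 3)))))
    (hslip : ∀ x ∈ frontier (unitCylinder : Set (EuclideanSpace ℝ (Fin 3))), ⟪V x, eR x⟫ = 0)
    (hper : IsAxiallyPeriodic L V) :
    ∫ x in {x : (EuclideanSpace ℝ (Fin 3)) | cylRadius x < 1 ∧ x 2 ∈ Icc 0 L}, VectorCalculus.divergence V x = 0 := by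
  -- notation
  set B : Set (Fin 3 → ℝ) := Icc ![-1, -1, 0] ![1, 1, L] with hB
  set ρ : (Fin 3 → ℝ) → ℝ := fun y => y 0 ^ 2 + y 1 ^ 2 with hρ
  set εn : ℕ → ℝ := fun n => 1 / ((n : ℝ) + 4) with hεn
  have hεpos : ∀ n, 0 < εn n := fun n => by positivity
  have hεle : ∀ n, εn n ≤ 1 / 4 := fun n =>
    one_div_le_one_div_of_le (by norm_num) (by linarith [(n.cast_nonneg : (0 : ℝ) ≤ n)])
  set A : ℕ → (Fin 3 → ℝ) → ℝ := fun n y =>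
    Real.smoothTransition ((1 - (y 0 ^ 2 + y 1 ^ 2)) / εn n - 1) *
      VectorCalculus.divergence V (toLp 2 y) with hA
  set Bf : ℕ → (Fin 3 → ℝ) → ℝ := fun n y =>
    deriv Real.smoothTransition ((1 - (y 0 ^ 2 + y 1 ^ 2)) / εn n - 1) * (-2 / εn n) *
      (y 0 * V (toLp 2 y) 0 + y 1 * V (toLp 2 y) 1) with hBf
  set Ainf : (Fin 3 → ℝ) → ℝ := fun y =>
    if ρ y < 1 then VectorCalculus.divergence V (toLp 2 y) else 0 with hAinf
  have hBz : ∀ y ∈ B, y 2 ∈ Icc 0 L := fun y hy =>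
    ⟨by simpa using hy.1 2, by simpa using hy.2 2⟩
  -- continuity and integrability of the two integrands
  have hAc : ∀ n, Continuous (A n) := fun n => continuous_cutoff_mul_divergence (hεpos n) hV
  have hBc : ∀ n, Continuous (Bf n) := fun n => continuous_cutoffDeriv_mul_flux (hεpos n) hV
  have hAi : ∀ n, IntegrableOn (A n) B :=
    fun n => (hAc n).continuousOn.integrableOn_compact isCompact_Icc
  have hBi : ∀ n, IntegrableOn (Bf n) B :=
    fun n => (hBc n).continuousOn.integrableOn_compact isCompact_Icc
  -- the box identity
  have hbox : ∀ n, ∫ y in B, A n y = -∫ y in B, Bf n y := by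
    intro n
    have h : ∫ y in B, (A n y + Bf n y) = 0 :=
      setIntegral_box_cutoff_divergence_eq_zero hL (hεpos n) hV hper
    rw [integral_add (hAi n) (hBi n)] at h
    linarith
  -- the constants
  obtain ⟨D, hD0, hD⟩ := exists_bound_divergence_periodCell hL hV
  obtain ⟨Cψ, hCψ0, hCψ⟩ := exists_bound_deriv_smoothTransition
  obtain ⟨Ch, hCh0, hCh⟩ := exists_bound_radialFlux hL hV hslip
  -- the arguments of the cut-off tend to `+∞` inside the cylinder
  have hargs : ∀ y, ρ y < 1 →
      Tendsto (fun n : ℕ => (1 - (y 0 ^ 2 + y 1 ^ 2)) / εn n - 1) atTop atTop := by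
    intro y hy
    have e : (fun n : ℕ => (1 - (y 0 ^ 2 + y 1 ^ 2)) / εn n - 1) =
        fun n : ℕ => (1 - ρ y) * (n : ℝ) + ((1 - ρ y) * 4 - 1) := by
      funext n
      simp only [hεn, hρ]
      field_simp
      ring
    rw [e]
    have hpos : 0 < 1 - ρ y := by linarith
    exact tendsto_atTop_add_const_right _ _ (tendsto_natCast_atTop_atTop.const_mul_atTop hpos)
  -- (1) dominated convergence for the cut-off divergence
  have hA_bound : ∀ n, ∀ y ∈ B, ‖A n y‖ ≤ D := by
    intro n y hy
    rw [Real.norm_eq_abs]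
    by_cases hy1 : ρ y < 1
    · have h1 : |Real.smoothTransition ((1 - (y 0 ^ 2 + y 1 ^ 2)) / εn n - 1)| ≤ 1 :=
        abs_le.2 ⟨by linarith [Real.smoothTransition.nonneg ((1 - (y 0 ^ 2 + y 1 ^ 2)) / εn n - 1)],
          Real.smoothTransition.le_one _⟩
      have h2 : |VectorCalculus.divergence V (toLp 2 y)| ≤ D :=
        hD _ ((cylRadius_toLp_lt_one_iff y).2 hy1) (hBz y hy)
      calc |A n y| = |Real.smoothTransition ((1 - (y 0 ^ 2 + y 1 ^ 2)) / εn n - 1)| *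
            |VectorCalculus.divergence V (toLp 2 y)| := abs_mul _ _
        _ ≤ 1 * D := mul_le_mul h1 h2 (abs_nonneg _) zero_le_one
        _ = D := one_mul D
    · have hlt : 1 - εn n < y 0 ^ 2 + y 1 ^ 2 := by linarith [not_lt.1 hy1, hεpos n]
      have e : A n y = 0 := by
        simp only [hA]
        rw [(cutoff_eq_zero_of_lt (hεpos n) hlt).1, zero_mul]
      rw [e, abs_zero]
      exact hD0
  have hA_lim : ∀ y, Tendsto (fun n => A n y) atTop (𝓝 (Ainf y)) := by
    intro y
    by_cases hy1 : ρ y < 1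
    · have hev : (fun n => A n y) =ᶠ[atTop] fun _ => Ainf y := by
        filter_upwards [(hargs y hy1).eventually_ge_atTop 1] with n hn
        simp only [hA, hAinf, if_pos hy1]
        rw [Real.smoothTransition.one_of_one_le hn, one_mul]
      exact (tendsto_congr' hev).2 tendsto_const_nhds
    · have hev : ∀ n, A n y = Ainf y := fun n => by
        have hlt : 1 - εn n < y 0 ^ 2 + y 1 ^ 2 := by linarith [not_lt.1 hy1, hεpos n]
        simp only [hA, hAinf, if_neg hy1]
        rw [(cutoff_eq_zero_of_lt (hεpos n) hlt).1, zero_mul]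
      simp only [hev]
      exact tendsto_const_nhds
  have hA_tend : Tendsto (fun n => ∫ y in B, A n y) atTop (𝓝 (∫ y in B, Ainf y)) := by
    refine tendsto_integral_of_dominated_convergence (fun _ => D)
      (fun n => (hAc n).aestronglyMeasurable) ?_
      (fun n => ae_restrict_of_forall_mem measurableSet_Icc (hA_bound n))
      (ae_of_all _ hA_lim)
    exact integrableOn_const (measure_Icc_lt_top (a := ![-1, -1, 0]) (b := ![1, 1, L])).ne
  -- (2) dominated convergence for the flux term
  have hB_bound : ∀ n, ∀ y ∈ B, ‖Bf n y‖ ≤ 4 * Cψ * Ch := by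
    intro n y hy
    have h4 : 0 ≤ 4 * Cψ * Ch := by positivity
    rw [Real.norm_eq_abs]
    set s : ℝ := (1 - (y 0 ^ 2 + y 1 ^ 2)) / εn n - 1 with hs
    by_cases hs0 : s < 0
    · simp only [hBf]
      rw [deriv_smoothTransition_of_nonpos hs0.le, zero_mul, zero_mul, abs_zero]
      exact h4
    by_cases hs1 : 1 < s
    · simp only [hBf]
      rw [deriv_smoothTransition_of_one_le hs1.le, zero_mul, zero_mul, abs_zero]
      exact h4
    -- the shell `ε ≤ 1 - ρ ≤ 2ε`
    have hε := hεpos n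
    have h1 : εn n ≤ 1 - ρ y := by
      have h' : 0 ≤ (1 - (y 0 ^ 2 + y 1 ^ 2)) / εn n - 1 := not_lt.1 hs0
      rw [sub_nonneg, le_div_iff₀ hε] at h'
      simp only [hρ]
      linarith
    have h2 : 1 - ρ y ≤ 2 * εn n := by
      have h' : (1 - (y 0 ^ 2 + y 1 ^ 2)) / εn n - 1 ≤ 1 := not_lt.1 hs1
      rw [sub_le_iff_le_add, div_le_iff₀ hε] at h'
      simp only [hρ]
      linarith
    have hρlt : ρ y < 1 := by linarith
    have hρpos : 0 < ρ y := by linarith [hεle n]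
    set x : (EuclideanSpace ℝ (Fin 3)) := toLp 2 y with hx
    have hr : cylRadius x = Real.sqrt (ρ y) := rfl
    have hr0 : 0 < cylRadius x := by rw [hr]; exact Real.sqrt_pos.2 hρpos
    have hr1 : cylRadius x ≤ 1 := by rw [hr]; exact Real.sqrt_le_one.2 hρlt.le
    have hflux : |x 0 * V x 0 + x 1 * V x 1| ≤ Ch * (1 - cylRadius x) := hCh x hr0 hr1 (hBz y hy)
    have h1r : 1 - cylRadius x ≤ 1 - ρ y := by
      have hsq : ρ y ≤ Real.sqrt (ρ y) := by
        rw [Real.le_sqrt hρpos.le hρpos.le]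
        nlinarith
      rw [hr]
      linarith
    have habs : |(-2 : ℝ) / εn n| = 2 / εn n := by
      rw [abs_div, abs_of_pos hε, abs_neg, abs_two]
    calc |Bf n y| = |deriv Real.smoothTransition s| * (2 / εn n) * |x 0 * V x 0 + x 1 * V x 1| := by
          simp only [hBf, abs_mul, habs, hs, hx, PiLp.toLp_apply]
      _ ≤ Cψ * (2 / εn n) * (Ch * (1 - ρ y)) := by
          gcongr
          · exact hCψ s
          · exact hflux.trans (by gcongr)
      _ ≤ Cψ * (2 / εn n) * (Ch * (2 * εn n)) := by gcongr
      _ = 4 * Cψ * Ch := by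
          field_simp
          ring
  have hB_lim : ∀ y, Tendsto (fun n => Bf n y) atTop (𝓝 0) := by
    intro y
    by_cases hy1 : ρ y < 1
    · have hev : (fun n => Bf n y) =ᶠ[atTop] fun _ => (0 : ℝ) := by
        filter_upwards [(hargs y hy1).eventually_gt_atTop 1] with n hn
        simp only [hBf]
        rw [deriv_smoothTransition_of_one_le hn.le, zero_mul, zero_mul]
      exact (tendsto_congr' hev).2 tendsto_const_nhds
    · have hev : ∀ n, Bf n y = 0 := fun n => by
        have hlt : 1 - εn n < y 0 ^ 2 + y 1 ^ 2 := by linarith [not_lt.1 hy1, hεpos n]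
        simp only [hBf]
        rw [(cutoff_eq_zero_of_lt (hεpos n) hlt).2, zero_mul, zero_mul]
      simp only [hev]
      exact tendsto_const_nhds
  have hB_tend : Tendsto (fun n => ∫ y in B, Bf n y) atTop (𝓝 (∫ _y in B, (0 : ℝ))) := by
    refine tendsto_integral_of_dominated_convergence (fun _ => 4 * Cψ * Ch)
      (fun n => (hBc n).aestronglyMeasurable) ?_
      (fun n => ae_restrict_of_forall_mem measurableSet_Icc (hB_bound n))
      (ae_of_all _ hB_lim)
    exact integrableOn_const (measure_Icc_lt_top (a := ![-1, -1, 0]) (b := ![1, 1, L])).ne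
  -- (3) the limit identity `∫_B Ainf = 0`
  have hA0 : ∫ y in B, Ainf y = 0 := by
    rw [integral_zero] at hB_tend
    have h1 : Tendsto (fun n => ∫ y in B, A n y) atTop (𝓝 (-0)) :=
      (tendsto_congr fun n => hbox n).2 hB_tend.neg
    rw [neg_zero] at h1
    exact tendsto_nhds_unique hA_tend h1
  -- (4) transport to the period cell of the cylinder
  have hS : MeasurableSet {y : Fin 3 → ℝ | y 0 ^ 2 + y 1 ^ 2 < 1} :=
    measurableSet_lt continuous_rhoSq.measurable measurable_const
  have hind : ∫ y in B, Ainf y =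
      ∫ y in {y : Fin 3 → ℝ | y 0 ^ 2 + y 1 ^ 2 < 1} ∩ B, VectorCalculus.divergence V (toLp 2 y) := by
    have e : Ainf = {y : Fin 3 → ℝ | y 0 ^ 2 + y 1 ^ 2 < 1}.indicator
        (fun y => VectorCalculus.divergence V (toLp 2 y)) := by
      funext y
      simp only [hAinf, hρ, Set.indicator_apply, mem_setOf_eq]
    rw [e, integral_indicator hS, Measure.restrict_restrict hS]
  have hmp : MeasurePreserving (ofLp : (EuclideanSpace ℝ (Fin 3)) → (Fin 3 → ℝ)) volume volume :=
    PiLp.volume_preserving_ofLp (Fin 3)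
  have hemb : MeasurableEmbedding (ofLp : (EuclideanSpace ℝ (Fin 3)) → (Fin 3 → ℝ)) :=
    (MeasurableEquiv.toLp 2 (Fin 3 → ℝ)).symm.measurableEmbedding
  have htrans := hmp.setIntegral_preimage_emb hemb
    (fun y => VectorCalculus.divergence V (toLp 2 y)) ({y : Fin 3 → ℝ | y 0 ^ 2 + y 1 ^ 2 < 1} ∩ B)
  simp only [toLp_ofLp] at htrans
  rw [hB, preimage_ofLp_box_inter_cylinder L] at htrans
  rw [htrans, ← hB, ← hind, hA0]

end Literature.Analysis.FluidPDE
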